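import Summits.QuantumFields.BalabanUV.T4Continuum.Spine.NE1p.DressedSmallFieldSlotLettersWitnessEnd
import Summits.QuantumFields.BalabanUV.T4Continuum.Spine.NE1p.DressedSourceAnalyticSlotLettersTorus

/-!
# T⁴ programme, spine estimate NE1′ (node O3b/H2) — WITNESS W66 (follower of W58 «THE SLOT-LETTERS END FIRES ON THE TORUS»): THE ANALYTIC TORUS
# ENDs OF ROW S50 FIRE ON W58's DATUM — S50-A's `analytic_and_bounded_locE_of_coreLettersOf_torus` (holomorphy in the source + the (2.41)-KIND
# envelope), `muDeriv_locE_le_of_coreLettersOf_torus` (linear response) and `analytic_and_bounded_locE_opSource_of_coreLettersOf_torus` (JOINT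
# (operator datum, source) holomorphy) APPLIED ONCE BY NAME each, for EVERY driven two-run object `D` and EVERY run-B background `U`, along the
# source pencil `0 + s • wW D`; the holomorphic pencil is NOT constant

Cell `pub-balaban`, sub-cell `t4`, row NE1′ formalisation crew (`t4/formal/NE1p/LEAVES.md` row W66 ∕ DAG N29zzzs «S50-A's THREE ANALYTIC TORUS ENDs FIRE
ON W58's DATUM», BOOKED typer R-T137 as a NEW row — not a fourth part of W58 ∕ N29zzzf, which is ✓✓ 3∕3 and closed for reading; INTENT `CLAIMS.log`
l.21870; S50 = leaf-07-g17's «S46 on the torus» (module A `DressedSourceAnalyticSlotLettersTorus`, p237028), READ by this seat as X186), unit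
`b2b-balaban-t4-ne1p-formalise-leaf-04` (LEAF PROVER 04, gen 15).  ADDITIVE — imports W58 PART 2 `Spine/NE1p/DressedSmallFieldSlotLettersWitnessEnd` (⇒ PART 1:
the datum `AW D`, `PW D`, `ctrW D`, S30 §1's conditions `hbase_W`∕`hrdm_W`∕`hrd_W`∕`hctr_W`∕`hbud_W`∕`hmq_W`; PART 2: `termsW`, `wW`, `norm_wW_le`, `sW_le`,
`hsmall_W`, `hM3_W`, `slotLettersEnd_live`) and S50-A `Spine/NE1p/DressedSourceAnalyticSlotLettersTorus` (leaf-07-g17, p237028; ⇒ S46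
`DressedSourceAnalyticSlotLetters` ⇒ S33 §4 ∕ S42 §5 at the letters of record) ONLY — both LANDED; THEOREMS ONLY (0 def, 0 `def … : Prop`, 0 cite,
0 sorry); nothing of S50 ∕ S46 ∕ PART 1 ∕ PART 2 restated — used BY NAME.

WHAT.  S50-A put the unit's three ANALYTIC ENDs at the substrate's Gaussian letters of record on pv22's torus, with every binder DISPLAYED; no module applies
them (X186's grep: S50-A's three theorems occur in S50-A only).  On PART 1's decided `ActLetters` datum every displayed binder is a NAMED LEMMA already (the
same terms that fire S31 §1 in PART 2 §5), so the three ENDs fire with NO new arithmetic — source radius `μ₁ := 2` (= PART 2's `ϱ`), response floor `μ₀ := 1`: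
* §11 **`sourcePencil_analytic_fires_torus D N U k`** — S50-A thm 1 ONCE BY NAME: `s ↦ E[Σ_{p ∈ termsW Z} actOfLetters (PW D) ℂ … (coreLettersOf … (AW D))
  p.1 p.2 0 (0 + s • wW D)](X₀)` is complex differentiable on `‖s‖ < 2` and bounded there by `e·9·64·K₀(64,8)²·(0 + 2·(A∕2))·e^{−0·d(X₀)}`;
  **`sourcePencil_response_fires_torus`** — thm 2 ONCE: `‖∂_s E[…](sμ)‖ ≤ 2·(that)∕(2 − 1)` for `‖sμ‖ ≤ 1`; **`opSource_joint_fires_torus`** — thm 3 ONCE: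
  `(o, s) ↦ E[… o (0 + s • wW D)](X₀)` jointly holomorphic on `ball 0 (1∕2) ×ˢ ball 0 2` with the same envelope — here S30 §1's operator-HOLOMORPHY
  clause of the LIVE Gaussian letters (`o ↦ (2 + ϑW·o)^{1∕2}`, `o ↦ ½(2 + ϑW·o)(v 0)²` on the operator ball, PART 1 §3) is load-bearing, not only their
  bounds; conclusions LITERALLY S50-A's torus currency at the instantiation.
* §11 GENUINE **`sourcePencil_live`**: the holomorphic pencil takes DIFFERENT values at `s = 1` and `s = 0` (PART 2 §6 `slotLettersEnd_live` after
  `one_smul`∕`zero_smul`) — it is not a constant function on `ball 0 2` (`pencil_points_mem`), so the differentiability∕response statements are exercised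
  on a non-trivial function.

HONEST FRAMING (typer R-T133∕R-T134∕R-T137 wording + rider ADOPTED).  A DECIDED TOY ([folklore]; 0 sorry; 0 citations; no `def`): S50-A's three by-name
re-letterings of the unit's analytic ENDs applied ONCE each to PART 1's `ActLetters` datum — a vacuity check of S50-A (hence of S46 §2∕§3 at the torus) on
OUR 1×1 Gaussian table, nothing more; analyticity of PRINT's densities ([Balaban1988RGII] (2.14)∕(2.41) — TYPE∕CONTEXT) is NOT proved: the holomorphy
here is that of OUR toy activity (a Gaussian integral of an entire integrand), obtained through the crew's kernel ENDs; (B1b) by definition of the toy;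
(B3) `hM3` met BY CHOICE of `rW` — G-ne9p2-5 UNPRINTED for Bałaban's cores; `μ₁ = 2`, `μ₀ = 1` are OUR toy radii — k2: no numeral of print; 0 binders
instantiated on Bałaban's densities; no wall item; the NE1′ wall (wording v1.8, T4-DAG v48; kind v1.7) does NOT move; R-t4r2-Q2 NOT met thereby; NE1′ ⇐
the named binders — NOT proved, NOT printed; spine PROVED 0∕9; count 9 unchanged.  Rung (B)+1 on ONE finite four-torus — NOT infinite volume, NOT a mass
gap, NOT OS on ℝ⁴, NOT Clay.  HONEST DEPENDENCY: continuum YM on T⁴ ⇐ BetaPertH ∧ nine spine estimates (0/9 proved); BetaPertH ⇐ (D1) ∧ (D4) ∧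
CAP+tail; G-an2-4 gates asym, D1 and NE2/3/4.
-/

noncomputable section

namespace Summit.QuantumFields.BalabanUV.T4Continuum.NE1p.DressedSmallFieldSlotLettersWitnessAnalytic

open Set Metric MeasureTheory Complex
open scoped BigOperators Matrix
open Literature.MathematicalPhysics.QuantumFieldTheory.Balaban1983to89
open Literature.MathematicalPhysics.QuantumFieldTheory.Balaban1983to89.B12TreeDecay (K₀ K₀_pos)
open Literature.MathematicalPhysics.QuantumFieldTheory.Balaban1983to89.B13Resummation (locE)
open Literature.MathematicalPhysics.QuantumFieldTheory.Balaban1983to89.TreeLengthTorus (TDom tsys torusTreeLen torusTreeLen_singleton)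
open Literature.MathematicalPhysics.QuantumFieldTheory.Balaban1983to89.TreeLengthTorusGeometry (tgeometry TTouch)
open Summit.QuantumFields.BalabanUV.T4Continuum.B13HistMeasurable (MeasPotFrame B13HistM)
open Summit.QuantumFields.BalabanUV.T4Continuum.B13Carriers (TwoRuns singleDom)
open Summit.QuantumFields.BalabanUV.T4Continuum.SubstrateTwoRunsDriven (DrivenRuns)
open Summit.QuantumFields.BalabanUV.T4Continuum.SubstrateActivities (CoreLetters coreOf actOfLetters)
open Summit.QuantumFields.BalabanUV.T4Continuum.SubstrateSlotsOfRecord (ActLetters coreLettersOf)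
open Summit.QuantumFields.BalabanUV.T4Continuum.NE1p.DressedSourceAnalyticSlotLettersTorus (analytic_and_bounded_locE_of_coreLettersOf_torus
  muDeriv_locE_le_of_coreLettersOf_torus analytic_and_bounded_locE_opSource_of_coreLettersOf_torus)
open Summit.QuantumFields.BalabanUV.T4Continuum.NE1p.DressedSmallFieldCoresWitness (E1 Acst Acst_pos)
open Summit.QuantumFields.BalabanUV.T4Continuum.NE1p.DressedSmallFieldTorusWitness (X₀ X₀_val eq_X₀_iff hrate_torus_num)
open Summit.QuantumFields.BalabanUV.T4Continuum.NE1p.DressedSmallFieldSlotLettersWitness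
open Summit.QuantumFields.BalabanUV.T4Continuum.NE1p.DressedSmallFieldSlotLettersWitnessEnd

variable {G : Type} [GaugeGroup G] (D : DrivenRuns G)

section Torus
variable (N : ℕ) [NeZero N]

open Classical in
/-- **S50-A §1 FIRES — THE DRESSED OUTPUT OF THE SLOT ACTIVITIES OF RECORD IS HOLOMORPHIC IN THE SOURCE along the pencil `0 + s • wW`, with the
(2.41)-KIND envelope, for EVERY driven two-run object `D` and EVERY run-B background `U`** [decided toy]: `analytic_and_bounded_locE_of_coreLettersOf_torus
D (PW D) ℂ … (AW D)` APPLIED ONCE BY NAME at `o := 0`, `h₀ := 0`, `v := wW D`, source radius `μ₁ := 2`, `A′ := 0 + 2·(A∕2)`, every other binder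
PART 1∕PART 2's named lemma (`hM3 := hM3_W`, `hsmall := hsmall_W`, `hrate := hrate_torus_num`); conclusion LITERALLY S50-A's torus currency. [folklore] -/
theorem sourcePencil_analytic_fires_torus (U : D.carriers.BgB) (k : ℕ) :
    DifferentiableOn ℂ (fun s => locE (Dom := (tsys 4 N).Dom) (TTouch (d := 4) (N := N)) (fun Z : (tsys 4 N).Dom => Z.1)
        (fun Z => ∑ p ∈ (termsW D) N Z, actOfLetters (PW D) ℂ (𝒵W D) (domW D) (JcW D) (VW D) (ℓW D) p.1 p.2 (0 : ℂ)
          ((0 : B13HistM (PW D)) + s • (wW D))) (X₀ N).1) (ball (0 : ℂ) 2) ∧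
      ∀ s ∈ ball (0 : ℂ) 2, ‖locE (Dom := (tsys 4 N).Dom) (TTouch (d := 4) (N := N)) (fun Z : (tsys 4 N).Dom => Z.1)
        (fun Z => ∑ p ∈ (termsW D) N Z, actOfLetters (PW D) ℂ (𝒵W D) (domW D) (JcW D) (VW D) (ℓW D) p.1 p.2 (0 : ℂ)
          ((0 : B13HistM (PW D)) + s • (wW D))) (X₀ N).1‖ ≤
        Real.exp 1 * 9 * 64 * K₀ 64 8 ^ 2 * (0 + 2 * (Acst / 2)) * Real.exp (-(0 * torusTreeLen (X₀ N).1)) :=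
  analytic_and_bounded_locE_of_coreLettersOf_torus D (PW D) ℂ (𝒵W D) (domW D) (JcW D) (VW D) (mIW D) (AW D)
    (W := Set.univ) (ctr := (ctrW D)) (ROp := fun _ => 1 / 2) (RHist := fun _ => 2) (R' := fun _ => 1)
    (β₀ := fun _ _ => 2) (ϑ := fun _ _ => ϑW) (d₀ := fun _ _ => 2) (γ := fun _ _ => 2)
    (fun _ => by norm_num) (fun _ => zero_le_one) (hbase_W D) (hrdm_W D) (fun _ _ => by norm_num) (fun _ _ => by norm_num) (hrd_W D)
    (hctr_W D) (hbud_W D) (hmq_W D)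
    (k := k) (g := fun _ => 0) (Set.mem_univ _) (U := U) (o := 0) (h₀ := 0) (v := (wW D)) (μ₁ := 2)
    (by show ‖(0 : ℂ) - 0‖ ≤ 1 / 2; simp)
    (by show ‖(0 : B13HistM (PW D)) - 0‖ + 2 * ‖(wW D)‖ ≤ 2; rw [sub_zero, norm_zero, zero_add]; linarith [(norm_wW_le D), sW_le])
    (emb := fun _ => D.mkDom k (singleDom 0)) (fun _ => rfl) ((termsW D) N)
    (A' := 0 + 2 * (Acst / 2)) (R := 2 * (64 * Real.log 162) + 2) (r₁ := 0) (X₀ N)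
    (by have := Acst_pos; linarith) le_rfl hrate_torus_num hsmall_W (hM3_W D N k)

open Classical in
/-- **S50-A §1's RESPONSE FACE FIRES**: the source derivative at any `‖sμ‖ ≤ 1` (`μ₀ := 1 < μ₁ := 2`) of the dressed output along the pencil is
`≤ 2·(e·9·64·K₀(64,8)²·A·1)∕(2 − 1)` — `muDeriv_locE_le_of_coreLettersOf_torus` APPLIED ONCE BY NAME. [folklore] -/
theorem sourcePencil_response_fires_torus (U : D.carriers.BgB) (k : ℕ) {sμ : ℂ} (hμ : ‖sμ‖ ≤ 1) :
    ‖deriv (fun s => locE (Dom := (tsys 4 N).Dom) (TTouch (d := 4) (N := N)) (fun Z : (tsys 4 N).Dom => Z.1)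
        (fun Z => ∑ p ∈ (termsW D) N Z, actOfLetters (PW D) ℂ (𝒵W D) (domW D) (JcW D) (VW D) (ℓW D) p.1 p.2 (0 : ℂ)
          ((0 : B13HistM (PW D)) + s • (wW D))) (X₀ N).1) sμ‖ ≤
      2 * (Real.exp 1 * 9 * 64 * K₀ 64 8 ^ 2 * (0 + 2 * (Acst / 2)) * Real.exp (-(0 * torusTreeLen (X₀ N).1))) / (2 - 1) :=
  muDeriv_locE_le_of_coreLettersOf_torus D (PW D) ℂ (𝒵W D) (domW D) (JcW D) (VW D) (mIW D) (AW D)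
    (W := Set.univ) (ctr := (ctrW D)) (ROp := fun _ => 1 / 2) (RHist := fun _ => 2) (R' := fun _ => 1)
    (β₀ := fun _ _ => 2) (ϑ := fun _ _ => ϑW) (d₀ := fun _ _ => 2) (γ := fun _ _ => 2)
    (fun _ => by norm_num) (fun _ => zero_le_one) (hbase_W D) (hrdm_W D) (fun _ _ => by norm_num) (fun _ _ => by norm_num) (hrd_W D)
    (hctr_W D) (hbud_W D) (hmq_W D)
    (k := k) (g := fun _ => 0) (Set.mem_univ _) (U := U) (o := 0) (h₀ := 0) (v := (wW D)) (μ₁ := 2)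
    (by show ‖(0 : ℂ) - 0‖ ≤ 1 / 2; simp)
    (by show ‖(0 : B13HistM (PW D)) - 0‖ + 2 * ‖(wW D)‖ ≤ 2; rw [sub_zero, norm_zero, zero_add]; linarith [(norm_wW_le D), sW_le])
    (emb := fun _ => D.mkDom k (singleDom 0)) (fun _ => rfl) ((termsW D) N)
    (A' := 0 + 2 * (Acst / 2)) (R := 2 * (64 * Real.log 162) + 2) (r₁ := 0) (μ₀ := 1) (X₀ N) (sμ := sμ)
    (by have := Acst_pos; linarith) le_rfl hrate_torus_num hsmall_W (hM3_W D N k) (by norm_num) hμ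

open Classical in
/-- **S50-A §1's JOINT (OPERATOR DATUM, SOURCE) FACE FIRES**: the dressed output is jointly holomorphic on `ball 0 (1∕2) ×ˢ ball 0 2` with the same
envelope — `analytic_and_bounded_locE_opSource_of_coreLettersOf_torus` APPLIED ONCE BY NAME (S30 §1's operator-HOLOMORPHY clause of the LIVE Gaussian
letters is load-bearing here: `o ↦ (2 + ϑW·o)^{1∕2}` on the operator ball). [folklore] -/
theorem opSource_joint_fires_torus (U : D.carriers.BgB) (k : ℕ) :
    DifferentiableOn ℂ (fun z : ℂ × ℂ => locE (Dom := (tsys 4 N).Dom) (TTouch (d := 4) (N := N)) (fun Z : (tsys 4 N).Dom => Z.1)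
        (fun Z => ∑ p ∈ (termsW D) N Z, actOfLetters (PW D) ℂ (𝒵W D) (domW D) (JcW D) (VW D) (ℓW D) p.1 p.2 z.1
          ((0 : B13HistM (PW D)) + z.2 • (wW D))) (X₀ N).1) (ball ((ctrW D) k (fun _ => 0) U).1 ((fun _ : ℕ => (1 / 2 : ℝ)) k) ×ˢ ball (0 : ℂ) 2) ∧
      ∀ z ∈ ball ((ctrW D) k (fun _ => 0) U).1 ((fun _ : ℕ => (1 / 2 : ℝ)) k) ×ˢ ball (0 : ℂ) 2,
        ‖locE (Dom := (tsys 4 N).Dom) (TTouch (d := 4) (N := N)) (fun Z : (tsys 4 N).Dom => Z.1)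
          (fun Z => ∑ p ∈ (termsW D) N Z, actOfLetters (PW D) ℂ (𝒵W D) (domW D) (JcW D) (VW D) (ℓW D) p.1 p.2 z.1
            ((0 : B13HistM (PW D)) + z.2 • (wW D))) (X₀ N).1‖ ≤
        Real.exp 1 * 9 * 64 * K₀ 64 8 ^ 2 * (0 + 2 * (Acst / 2)) * Real.exp (-(0 * torusTreeLen (X₀ N).1)) :=
  analytic_and_bounded_locE_opSource_of_coreLettersOf_torus D (PW D) ℂ (𝒵W D) (domW D) (JcW D) (VW D) (mIW D) (AW D)
    (W := Set.univ) (ctr := (ctrW D)) (ROp := fun _ => 1 / 2) (RHist := fun _ => 2) (R' := fun _ => 1)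
    (β₀ := fun _ _ => 2) (ϑ := fun _ _ => ϑW) (d₀ := fun _ _ => 2) (γ := fun _ _ => 2)
    (fun _ => by norm_num) (fun _ => zero_le_one) (hbase_W D) (hrdm_W D) (fun _ _ => by norm_num) (fun _ _ => by norm_num) (hrd_W D)
    (hctr_W D) (hbud_W D) (hmq_W D)
    (k := k) (g := fun _ => 0) (Set.mem_univ _) (U := U) (h₀ := 0) (v := (wW D)) (μ₁ := 2)
    (by show ‖(0 : B13HistM (PW D)) - 0‖ + 2 * ‖(wW D)‖ ≤ 2; rw [sub_zero, norm_zero, zero_add]; linarith [(norm_wW_le D), sW_le])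
    (emb := fun _ => D.mkDom k (singleDom 0)) (fun _ => rfl) ((termsW D) N)
    (A' := 0 + 2 * (Acst / 2)) (R := 2 * (64 * Real.log 162) + 2) (r₁ := 0) (X₀ N)
    (by have := Acst_pos; linarith) le_rfl hrate_torus_num hsmall_W (hM3_W D N k)

open Classical in
/-- **GENUINE — THE HOLOMORPHIC SOURCE PENCIL IS NOT CONSTANT**: its values at `s = 1` (the dressed table `0 + wW`) and `s = 0` (the undressed
table) DIFFER (PART 2 §6's `slotLettersEnd_live`); both points lie in `ball 0 2`. [folklore] -/
theorem sourcePencil_live :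
    (fun s : ℂ => locE (Dom := (tsys 4 N).Dom) (TTouch (d := 4) (N := N)) (fun Z : (tsys 4 N).Dom => Z.1)
        (fun Z => ∑ p ∈ (termsW D) N Z, actOfLetters (PW D) ℂ (𝒵W D) (domW D) (JcW D) (VW D) (ℓW D) p.1 p.2 (0 : ℂ)
          ((0 : B13HistM (PW D)) + s • (wW D))) (X₀ N).1) 1 ≠
    (fun s : ℂ => locE (Dom := (tsys 4 N).Dom) (TTouch (d := 4) (N := N)) (fun Z : (tsys 4 N).Dom => Z.1)
        (fun Z => ∑ p ∈ (termsW D) N Z, actOfLetters (PW D) ℂ (𝒵W D) (domW D) (JcW D) (VW D) (ℓW D) p.1 p.2 (0 : ℂ)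
          ((0 : B13HistM (PW D)) + s • (wW D))) (X₀ N).1) 0 := by
  simp only [one_smul, zero_smul, add_zero]
  have h := slotLettersEnd_live D N
  unfold actSW at h
  rwa [zero_add] at h ⊢

/-- Both pencil points used above lie in the source ball `ball 0 2`. [folklore] -/
theorem pencil_points_mem : (1 : ℂ) ∈ ball (0 : ℂ) 2 ∧ (0 : ℂ) ∈ ball (0 : ℂ) 2 := by
  constructor <;> simp [Metric.mem_ball]

end Torus

end Summit.QuantumFields.BalabanUV.T4Continuum.NE1p.DressedSmallFieldSlotLettersWitnessAnalytic
end
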